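/- Free-seat work of WIDTH SEAT `ym-line-cbag-p1-w3` (prover-ym-line-cbag-p1-w3-g13-0), route `EguchiKawaiDirectionLadder`
(ideator ym-idea-2, LINE 8), crux `TripleSmallBallMargin` (stmt-QuantumFields-27724), LEAD g24's S10-D «margin_bookkeeping»
(STATUS 15:55:05Z; spec `HOME/l8/lead-g24/MarginBookkeepingSpec.lean`, signature verbatim with the spec's `blockLog` UNFOLDED —
DEF-FREE so the gate fast-lanes it; a caller's local `blockLog` definition matches by `rfl`): the pure-real
bookkeeping inequality of the crux assembly — VdM split `4^B` × block factors × (off-block factor)² has total log at most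
`N²((4/5) log t + C)`.  Pure real arithmetic over the tree's (D1)/(D2) of `…MarginArithmetic`; ROUTE-INDEPENDENT.  Nothing here
bears on the Yang–Mills mass gap (barrier-ledger line onto `EguchiKawaiBreakdown`). -/
import Summits.QuantumFields.YangMills.Theorems.EguchiKawaiDirectionLadderMarginArithmetic

/-!
# Route `EguchiKawaiDirectionLadder`, crux `TripleSmallBallMargin`: margin bookkeeping (S10-D)

Write `blockLog N q n₀ t K A₀ A₁ η n` (the LEAD's spec name; NOT declared here — this file is definition-free, the expression is
spelled out as the `if … then … else …` below, so `exact margin_bookkeeping …` closes a goal stated with any local definition of that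
name by definitional unfolding) for the log of the per-block factor bound used by the MAIN file: a block of size `n` is GOOD when
`n₀ ≤ n`, `6q ≤ n` and `K·N·t ≤ n`, and then its factor is
`exp((3/2)C(n,2)(log t + log(N/n)) + C(n,2)A₀ + n²A₁ − (3/2)η n² log t + 5qn log 100 − 10qn log t)`; otherwise it is the
trivial `4^{C(n,2)}` (cf. `BlockFactor.blockFactor_bound`, whose exponent is the same expression).

* `blockLog_le_linear` — the per-block bound: `blockLog n` is at most `(3/2)C(n,2)·log t` plus `|log t|`-linear losses
  `(3/2)(n₀²/2 + 3qn)|log t|` (blocks failing `n₀ ≤ n` or `6q ≤ n`), `(3/2)η n²|log t| + 10qn|log t|`, the `t`-free junk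
  `(3/2)C(n,2)log(N/n) + C(n,2)A₀ + n²A₁ + 5qn log 100 + C(n,2) log 4`, and the small-block term
  `(3/2)·[n ≤ KNt]·C(n,2)|log t|` (charged by (D2)).
* `margin_bookkeeping` — with `δ = ε = 1/10` (so `#ρ-close ordered pairs ≤ (13/20)N²`), collar `M = 2000`, `η = 1/1000`,
  `N ≥ 100`: `B log 4 + Σ_c blockLog(n_c) + 2(Cm N² + X(Γ + log t)) ≤ N²((4/5) log t + (2 log 4 + 1 + A₀ + A₁ + K + 2Cm + |Γ| +
  log 100))`.  The coefficient of `|log t|` is `(3/2)Σ_c C(n_c,2) + X/2 − … ≥ 0.8195 N² ≥ (4/5)N²`; the junk is absorbed by the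
  constant via (D1) `Σ C(n_c,2) log(N/n_c) ≤ N²/(2e)` and (D2) `Σ_{n_c ≤ KNt} C(n_c,2)|log t| ≤ KN²/(2e)`.
-/

set_option autoImplicit false

noncomputable section

namespace Summit.QuantumFields.YangMills.Theorems.EguchiKawaiDirectionLadder

open scoped BigOperators
open Finset Real

/-- **Per-block bound.** For `0 < t ≤ 1`, `n ≤ N` and nonnegative `A₀ A₁ η`, `blockLog n` is at most the good-block main term
`(3/2)C(n,2) log t` plus `|log t|`-linear losses and `t`-free junk, all linear in the block data
`C(n,2) = n(n−1)/2`, `n`, `n²`, `C(n,2) log(N/n)` and the small-block indicator term of (D2):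
in a good block the extra terms are nonnegative; in a block with `n < n₀` one has `C(n,2) ≤ n₀²/2`, with `n < 6q` one has
`C(n,2) ≤ 3qn`, and with `n < KNt` the indicator term returns `(3/2)C(n,2)|log t|`. -/
theorem blockLog_le_linear (N q n₀ : ℕ) {t K A₀ A₁ η : ℝ} (hA₀ : 0 ≤ A₀) (hA₁ : 0 ≤ A₁) (hη : 0 ≤ η)
    (ht : 0 < t) (ht1 : t ≤ 1) {n : ℕ} (hnN : n ≤ N) :
    (if n₀ ≤ n ∧ 6 * q ≤ n ∧ K * N * t ≤ n then
        (3 / 2) * ((n : ℝ) * ((n : ℝ) - 1) / 2) * (Real.log t + Real.log ((N : ℝ) / n)) +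
          ((n : ℝ) * ((n : ℝ) - 1) / 2) * A₀ + (n : ℝ) ^ 2 * A₁ - (3 / 2) * η * (n : ℝ) ^ 2 * Real.log t +
          5 * q * n * Real.log 100 - 10 * q * n * Real.log t
      else ((n : ℝ) * ((n : ℝ) - 1) / 2) * Real.log 4) ≤
      (3 / 2) * Real.log t * ((n : ℝ) * ((n : ℝ) - 1) / 2)
      + (3 / 2) * (-Real.log t) * ((n₀ : ℝ) ^ 2 / 2)
      + (9 / 2) * q * (-Real.log t) * n
      + (3 / 2) * η * (-Real.log t) * (n : ℝ) ^ 2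
      + 10 * q * (-Real.log t) * n
      + (3 / 2) * (((n : ℝ) * ((n : ℝ) - 1) / 2) * Real.log ((N : ℝ) / n))
      + A₀ * ((n : ℝ) * ((n : ℝ) - 1) / 2)
      + A₁ * (n : ℝ) ^ 2
      + 5 * q * Real.log 100 * n
      + Real.log 4 * ((n : ℝ) * ((n : ℝ) - 1) / 2)
      + (3 / 2) * (if (n : ℝ) ≤ K * N * t then ((n : ℝ) * ((n : ℝ) - 1) / 2) * (-Real.log t) else 0) := by
  have hL : 0 ≤ -Real.log t := by have := Real.log_nonpos ht.le ht1; linarith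
  have hn0 : (0 : ℝ) ≤ n := Nat.cast_nonneg n
  have hq0 : (0 : ℝ) ≤ q := Nat.cast_nonneg q
  have hC0 : 0 ≤ (n : ℝ) * ((n : ℝ) - 1) / 2 := by
    rcases Nat.eq_zero_or_pos n with h | h
    · simp [h]
    · have h1 : (1 : ℝ) ≤ n := by exact_mod_cast h
      have : 0 ≤ (n : ℝ) * ((n : ℝ) - 1) := mul_nonneg hn0 (by linarith)
      linarith
  have hlogNn : 0 ≤ Real.log ((N : ℝ) / n) := by
    rcases Nat.eq_zero_or_pos n with h | h
    · simp [h]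
    · have hnpos : (0 : ℝ) < n := by exact_mod_cast h
      have hnN' : (n : ℝ) ≤ N := by exact_mod_cast hnN
      exact Real.log_nonneg ((one_le_div hnpos).2 hnN')
  have hlog4 : 0 ≤ Real.log 4 := Real.log_nonneg (by norm_num)
  have hlog100 : 0 ≤ Real.log 100 := Real.log_nonneg (by norm_num)
  have h32 : (0 : ℝ) ≤ 3 / 2 := by norm_num
  -- nonnegativity of the loss / junk terms
  have hT2 : 0 ≤ (3 / 2) * (-Real.log t) * ((n₀ : ℝ) ^ 2 / 2) :=
    mul_nonneg (mul_nonneg h32 hL) (by positivity)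
  have hT3 : 0 ≤ (9 / 2) * q * (-Real.log t) * n :=
    mul_nonneg (mul_nonneg (mul_nonneg (by norm_num) hq0) hL) hn0
  have hT4 : 0 ≤ (3 / 2) * η * (-Real.log t) * (n : ℝ) ^ 2 :=
    mul_nonneg (mul_nonneg (mul_nonneg h32 hη) hL) (by positivity)
  have hT5 : 0 ≤ 10 * q * (-Real.log t) * n :=
    mul_nonneg (mul_nonneg (mul_nonneg (by norm_num) hq0) hL) hn0
  have hT6 : 0 ≤ (3 / 2) * (((n : ℝ) * ((n : ℝ) - 1) / 2) * Real.log ((N : ℝ) / n)) :=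
    mul_nonneg h32 (mul_nonneg hC0 hlogNn)
  have hT7 : 0 ≤ A₀ * ((n : ℝ) * ((n : ℝ) - 1) / 2) := mul_nonneg hA₀ hC0
  have hT8 : 0 ≤ A₁ * (n : ℝ) ^ 2 := mul_nonneg hA₁ (by positivity)
  have hT9 : 0 ≤ 5 * q * Real.log 100 * n :=
    mul_nonneg (mul_nonneg (mul_nonneg (by norm_num) hq0) hlog100) hn0
  have hT10 : 0 ≤ Real.log 4 * ((n : ℝ) * ((n : ℝ) - 1) / 2) := mul_nonneg hlog4 hC0
  have hCL : 0 ≤ ((n : ℝ) * ((n : ℝ) - 1) / 2) * (-Real.log t) := mul_nonneg hC0 hL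
  have hT11 : 0 ≤ (3 / 2) * (if (n : ℝ) ≤ K * N * t then ((n : ℝ) * ((n : ℝ) - 1) / 2) * (-Real.log t) else 0) := by
    refine mul_nonneg h32 ?_
    split_ifs
    · exact hCL
    · exact le_rfl
  by_cases hgood : n₀ ≤ n ∧ 6 * q ≤ n ∧ K * N * t ≤ n
  · -- GOOD block: the bound holds with room `(3/2)(n₀²/2 + 3qn)|log t| + C log 4 + (3/2)[…]`.
    rw [if_pos hgood]
    linarith [hT2, hT3, hT6, hT10, hT11]
  · -- BAD block: `blockLog = C log 4`; the negative main term is compensated case by case.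
    rw [if_neg hgood]
    rw [not_and_or, not_and_or] at hgood
    rcases hgood with hn₀ | h6q | hKNt
    · -- `n < n₀`: `C(n,2) ≤ n₀²/2`
      have hlt : (n : ℝ) ≤ n₀ := by exact_mod_cast (Nat.lt_of_not_le hn₀).le
      have hsq : (n : ℝ) * n ≤ (n₀ : ℝ) * n₀ := mul_le_mul hlt hlt hn0 (hn0.trans hlt)
      have hkey : 0 ≤ (-Real.log t) * ((n₀ : ℝ) ^ 2 / 2 - (n : ℝ) * ((n : ℝ) - 1) / 2) :=
        mul_nonneg hL (by nlinarith [hsq, hn0])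
      linarith [hkey, hT3, hT4, hT5, hT6, hT7, hT8, hT9, hT11]
    · -- `n < 6q`: `C(n,2) ≤ 3qn`
      have hlt : (n : ℝ) < 6 * q := by exact_mod_cast Nat.lt_of_not_le h6q
      have hmul : (n : ℝ) * ((n : ℝ) - 1) ≤ (n : ℝ) * (6 * q) :=
        mul_le_mul_of_nonneg_left (by linarith) hn0
      have hkey : 0 ≤ (-Real.log t) * (3 * q * n - (n : ℝ) * ((n : ℝ) - 1) / 2) :=
        mul_nonneg hL (by nlinarith [hmul])
      linarith [hkey, hT2, hT4, hT5, hT6, hT7, hT8, hT9, hT11]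
    · -- `n < KNt`: the (D2) indicator term returns `(3/2) C |log t|`
      have hle : (n : ℝ) ≤ K * N * t := (not_le.mp hKNt).le
      rw [if_pos hle]
      linarith [hT2, hT3, hT4, hT5, hT6, hT7, hT8, hT9]

/-- **Margin bookkeeping.** With `δ = ε = 1/10` (so `#ρ-close ordered pairs ≤ (13/20)N²`), collar `M = 2000`, `η = 1/1000`:
the total log of (VdM split `4^B`) × (block factors) × (off-block factor)² is at most `N²((4/5) log t + C)`.
The block sum is LITERALLY `∑ c, blockLog N q n₀ t K A₀ A₁ (1/1000) (n c)` of the LEAD's spec with `blockLog` unfolded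
(definition-free statement; a goal written with a local `blockLog` is closed by `exact margin_bookkeeping …`). -/
theorem margin_bookkeeping {m : ℕ} (n : Fin m → ℕ) (N q X B n₀ : ℕ) {t K A₀ A₁ Cm Γ : ℝ}
    (hK : 0 ≤ K) (hA₀ : 0 ≤ A₀) (hA₁ : 0 ≤ A₁) (hCm : 0 ≤ Cm)
    (ht : 0 < t) (ht1 : t ≤ 1) (hN : 100 ≤ N) (hn₀ : (m : ℝ) * (n₀ : ℝ) ^ 2 ≤ (N : ℝ) ^ 2 / 1000)
    (hsum : ∑ c, n c + q = N) (hq : (q : ℝ) ≤ N / 2000) (hB : (B : ℝ) ≤ X + q * N) (hXB : X ≤ B)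
    (hwithin : ∑ c, (n c).choose 2 + B = N.choose 2)
    (hX : (((N : ℝ) - N / 2000) ^ 2 - (13 / 20) * (N : ℝ) ^ 2) / 2 ≤ X) :
    (B : ℝ) * Real.log 4 +
        ∑ c, (if n₀ ≤ n c ∧ 6 * q ≤ n c ∧ K * N * t ≤ n c then
            (3 / 2) * ((n c : ℝ) * ((n c : ℝ) - 1) / 2) * (Real.log t + Real.log ((N : ℝ) / n c)) +
              ((n c : ℝ) * ((n c : ℝ) - 1) / 2) * A₀ + (n c : ℝ) ^ 2 * A₁ -
                (3 / 2) * (1 / 1000) * (n c : ℝ) ^ 2 * Real.log t +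
              5 * q * n c * Real.log 100 - 10 * q * n c * Real.log t
          else ((n c : ℝ) * ((n c : ℝ) - 1) / 2) * Real.log 4) +
        2 * (Cm * (N : ℝ) ^ 2 + X * (Γ + Real.log t)) ≤
      (N : ℝ) ^ 2 * ((4 / 5) * Real.log t + (2 * Real.log 4 + 1 + A₀ + A₁ + K + 2 * Cm + |Γ| + Real.log 100)) := by
  -- basic facts
  have hL : 0 ≤ -Real.log t := by have := Real.log_nonpos ht.le ht1; linarith
  have hNr : (100 : ℝ) ≤ N := by exact_mod_cast hN
  have hN0 : (0 : ℝ) ≤ N := by linarith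
  have hq0 : (0 : ℝ) ≤ q := Nat.cast_nonneg q
  have hB0 : (0 : ℝ) ≤ B := Nat.cast_nonneg B
  have hX0 : (0 : ℝ) ≤ X := Nat.cast_nonneg X
  have hXBr : (X : ℝ) ≤ B := by exact_mod_cast hXB
  have hlog4 : 0 ≤ Real.log 4 := Real.log_nonneg (by norm_num)
  have hlog100 : 0 ≤ Real.log 100 := Real.log_nonneg (by norm_num)
  have hexp : Real.exp (-1) ≤ 1 := Real.exp_le_one_iff.2 (by norm_num)
  have hN2 : 0 ≤ (N : ℝ) ^ 2 := sq_nonneg _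
  have hCmN : 0 ≤ Cm * (N : ℝ) ^ 2 := mul_nonneg hCm hN2
  -- casts of the combinatorial hypotheses
  have hsum_le : ∑ c, n c ≤ N := Nat.le.intro hsum
  have hle : ∀ c, n c ≤ N := fun c =>
    le_trans (Finset.single_le_sum (fun _ _ => Nat.zero_le _) (Finset.mem_univ c)) hsum_le
  have hsumR : ∑ c, (n c : ℝ) + q = N := by exact_mod_cast hsum
  have hwithinR : ∑ c, ((n c : ℝ) * ((n c : ℝ) - 1) / 2) + B = (N : ℝ) * ((N : ℝ) - 1) / 2 := by
    have h := congrArg (Nat.cast : ℕ → ℝ) hwithin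
    push_cast [Nat.cast_choose_two] at h
    linarith only [h]
  -- the block-sum facts ((D1), (D2), `Σ n_c ≤ N`, `Σ n_c² ≤ N²`, `0 ≤ Σ C(n_c,2) = C(N,2) − B`)
  have hD1 := sum_pairs_mul_log_div_le n N hsum_le
  have hD2 := sum_smallBlocks_pairs_mul_neg_log_le n N hsum_le hK ht ht1
  have hSn : ∑ c, (n c : ℝ) ≤ N := by linarith only [hsumR, hq0]
  have hSn2 : ∑ c, (n c : ℝ) ^ 2 ≤ (N : ℝ) ^ 2 := by
    have hterm : ∀ c, (n c : ℝ) ^ 2 ≤ (N : ℝ) * n c := fun c => by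
      have h1 : (n c : ℝ) ≤ N := by exact_mod_cast hle c
      rw [sq]
      exact mul_le_mul_of_nonneg_right h1 (Nat.cast_nonneg (n c))
    calc ∑ c, (n c : ℝ) ^ 2 ≤ ∑ c, (N : ℝ) * n c := Finset.sum_le_sum fun c _ => hterm c
      _ = (N : ℝ) * ∑ c, (n c : ℝ) := by rw [Finset.mul_sum]
      _ ≤ (N : ℝ) * N := mul_le_mul_of_nonneg_left hSn hN0
      _ = (N : ℝ) ^ 2 := by ring
  have hSC0 : 0 ≤ ∑ c, ((n c : ℝ) * ((n c : ℝ) - 1) / 2) := Finset.sum_nonneg fun c _ => by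
    rcases Nat.eq_zero_or_pos (n c) with h | h
    · simp [h]
    · have h1 : (1 : ℝ) ≤ n c := by exact_mod_cast h
      have h2 : 0 ≤ (n c : ℝ) * ((n c : ℝ) - 1) := mul_nonneg (by linarith) (by linarith)
      linarith only [h2]
  have hSCeq : ∑ c, ((n c : ℝ) * ((n c : ℝ) - 1) / 2) = (N : ℝ) * ((N : ℝ) - 1) / 2 - B :=
    eq_sub_of_add_eq hwithinR
  -- small arithmetic consequences of the numerical hypotheses
  have hSCle : ∑ c, ((n c : ℝ) * ((n c : ℝ) - 1) / 2) ≤ (N : ℝ) ^ 2 := by linarith only [hSCeq, hB0, hN0, hN2]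
  have hXle : (X : ℝ) ≤ (N : ℝ) ^ 2 / 2 := by linarith only [hXBr, hSCeq, hSC0, hN0]
  have hNN : (N : ℝ) ≤ (N : ℝ) ^ 2 / 100 := by
    have h := mul_nonneg hN0 (sub_nonneg.2 hNr)
    linarith only [h]
  have hqN : (q : ℝ) * N ≤ (N : ℝ) ^ 2 / 2000 := by
    have h := mul_le_mul_of_nonneg_right hq hN0
    linarith only [h]
  have hqSn : (q : ℝ) * ∑ c, (n c : ℝ) ≤ (N : ℝ) ^ 2 / 2000 := le_trans (mul_le_mul_of_nonneg_left hSn hq0) hqN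
  have hX2 : (1396001 / 8000000 : ℝ) * (N : ℝ) ^ 2 ≤ X := by
    have e : (((N : ℝ) - N / 2000) ^ 2 - (13 / 20) * (N : ℝ) ^ 2) / 2 = (1396001 / 8000000 : ℝ) * (N : ℝ) ^ 2 := by
      ring
    rw [e] at hX
    exact hX
  -- `|log t|`-multiplied facts
  have P1 : (-Real.log t) * ∑ c, ((n c : ℝ) * ((n c : ℝ) - 1) / 2) =
      (-Real.log t) * ((N : ℝ) * ((N : ℝ) - 1) / 2) - (-Real.log t) * B := by
    rw [hSCeq]; ring
  have P2 : (-Real.log t) * B ≤ (-Real.log t) * (X + q * N) := mul_le_mul_of_nonneg_left hB hL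
  have P3 : (-Real.log t) * ((q : ℝ) * N) ≤ (-Real.log t) * ((N : ℝ) ^ 2 / 2000) := mul_le_mul_of_nonneg_left hqN hL
  have P4 : (-Real.log t) * ((q : ℝ) * ∑ c, (n c : ℝ)) ≤ (-Real.log t) * ((N : ℝ) ^ 2 / 2000) :=
    mul_le_mul_of_nonneg_left hqSn hL
  have P5 : (-Real.log t) * ∑ c, (n c : ℝ) ^ 2 ≤ (-Real.log t) * (N : ℝ) ^ 2 := mul_le_mul_of_nonneg_left hSn2 hL
  have P6 : (-Real.log t) * ((m : ℝ) * (n₀ : ℝ) ^ 2) ≤ (-Real.log t) * ((N : ℝ) ^ 2 / 1000) :=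
    mul_le_mul_of_nonneg_left hn₀ hL
  have P7 : (-Real.log t) * ((1396001 / 8000000 : ℝ) * (N : ℝ) ^ 2) ≤ (-Real.log t) * X :=
    mul_le_mul_of_nonneg_left hX2 hL
  have P8 : (-Real.log t) * (N : ℝ) ≤ (-Real.log t) * ((N : ℝ) ^ 2 / 100) := mul_le_mul_of_nonneg_left hNN hL
  have P9 : 0 ≤ (-Real.log t) * (N : ℝ) ^ 2 := mul_nonneg hL hN2
  -- `t`-free facts
  have Q1 : Real.log 4 * ∑ c, ((n c : ℝ) * ((n c : ℝ) - 1) / 2) + Real.log 4 * B =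
      Real.log 4 * ((N : ℝ) * ((N : ℝ) - 1) / 2) := by
    rw [hSCeq]; ring
  have Q2 : 0 ≤ Real.log 4 * N := mul_nonneg hlog4 hN0
  have Q3 : 0 ≤ Real.log 4 * (N : ℝ) ^ 2 := mul_nonneg hlog4 hN2
  have Q4 : (N : ℝ) ^ 2 * Real.exp (-1) ≤ (N : ℝ) ^ 2 := mul_le_of_le_one_right hN2 hexp
  have Q5 : A₀ * ∑ c, ((n c : ℝ) * ((n c : ℝ) - 1) / 2) ≤ A₀ * (N : ℝ) ^ 2 := mul_le_mul_of_nonneg_left hSCle hA₀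
  have Q6 : A₁ * ∑ c, (n c : ℝ) ^ 2 ≤ A₁ * (N : ℝ) ^ 2 := mul_le_mul_of_nonneg_left hSn2 hA₁
  have Q7 : Real.log 100 * ((q : ℝ) * ∑ c, (n c : ℝ)) ≤ Real.log 100 * ((N : ℝ) ^ 2 / 2000) :=
    mul_le_mul_of_nonneg_left hqSn hlog100
  have Q8 : 0 ≤ Real.log 100 * (N : ℝ) ^ 2 := mul_nonneg hlog100 hN2
  have Q9 : K * (N : ℝ) ^ 2 * Real.exp (-1) ≤ K * (N : ℝ) ^ 2 := mul_le_of_le_one_right (mul_nonneg hK hN2) hexp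
  have Q10 : 0 ≤ K * (N : ℝ) ^ 2 := mul_nonneg hK hN2
  have Q11 : (X : ℝ) * Γ ≤ X * |Γ| := mul_le_mul_of_nonneg_left (le_abs_self Γ) hX0
  have Q12 : (X : ℝ) * |Γ| ≤ ((N : ℝ) ^ 2 / 2) * |Γ| := mul_le_mul_of_nonneg_right hXle (abs_nonneg Γ)
  -- the sum of the per-block bounds, evaluated as a combination of the block sums
  have hA := Finset.sum_le_sum (s := (Finset.univ : Finset (Fin m))) fun c _ =>
    blockLog_le_linear N q n₀ (K := K) hA₀ hA₁ (by norm_num : (0 : ℝ) ≤ 1 / 1000) ht ht1 (hle c)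
  simp only [Finset.sum_add_distrib, ← Finset.mul_sum, Finset.sum_const, Finset.card_univ, Fintype.card_fin,
    nsmul_eq_mul] at hA
  -- conclude (linear in the block sums and the listed products)
  linarith only [hA, hD1, hD2, P1, P2, P3, P4, P5, P6, P7, P8, P9, Q1, Q2, Q3, Q4, Q5, Q6, Q7, Q8, Q9, Q10, Q11, Q12,
    hN2, hCmN]

end Summit.QuantumFields.YangMills.Theorems.EguchiKawaiDirectionLadder

end
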